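import Summits.BirchSwinnertonDyer.BirchSwinnertonDyer.Theorems.ByReductionTypeAtTwoRankOneAtTwoOffBigImageOddLocalEngineStubVocabulary
import HarnessLib

/-!
# Route `ByReductionTypeAtTwo`, crux `RankOneAtTwoOffBigImageOddLocal` (stmt-BirchSwinnertonDyer-23716), line
# `refined_kolyvagin_tamagawa_shift_at_two` — ENGINE PORT `c₀ ↦ h₀` (regular element), §N LOCAL TRIVIALITY at regular Kolyvagin primes (E4-β): `E(K̄)[2^{n+1}] = E(K_λ)[2^{n+1}]`

Lead prover `prover-cruxlead-stmt-BirchSwinnertonDyer-23716-g0` (2026-08-28), landing the crux-plan g6 ENGINE QUARRY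
`Cruxes/RankOneAtTwoOffBigImageOddLocal/RefinedKolyvaginEngineG6.lean` (planner `cruxplan-…-23716-refined-kolyvag-9ff2fe475f-g6`, v10, ≈2800 lines,
rc 0 / 0 sorry; `Cruxes/` files are not importable, so the lead COPIES the proofs into `Theorems/` — card «LEAD QUICKSTART (g6)» Q2 #3 / Q4) as
`--supports stmt-BirchSwinnertonDyer-23716` helpers, continuing `…Engine{Dictionary,Parity,Cyclotomic,CyclotomicBasis,GoursatLift,Chebotarev,RegularSupply,
RegularLift}.lean`.  The engine port = kernel-closable item #3 of the pen's order (PEN-PICK-23716 ADD-4): Kolyvagin primes whose Frobenius is a REGULAR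
element `h₀` (det `−1`, trace `0`, odd mod `2`; LOSSLESS local Kummer maps by R1/LKL) instead of complex conjugation `c₀` (which loses the top bit at
`Δ > 0`, residual 24883), with McCallum's exact local orders — the supply the line's filtered stubs `…WithOn Φ_reg Ω` consume (card #7
`regular-frobenius-kolyvagin-primes-pos-disc`).  THIS FILE: §N (quarry annex `RefinedKolyvaginEngineG6LocalN.lean`, v12) — the regular analogues of the two Gross-notion lemmas every Euler-system local computation at `λ` starts from (`exists_isArithFrobAt_mem_torsionFixing`, `absGaloisRestrict_smul_geomTorsion_eq_of_kolyvaginPrime(_pow)`: «`λ` splits completely in `K(E[p^M])`») with `FrobEqFrobInfty` REPLACED by the regular Frobenius clause exported by `Engine.exists_regular_kolyvaginPrime_of_heegner` plus the involution clause `h₀² = 1` on `E[m]`: `exists_isArithFrobAt_mem_torsionFixing_regular`, `absGaloisRestrict_smul_geomTorsion_eq_regular`, the good-reduction dictionary `hasGoodReductionAt_baseChange_of_rat` / `hasGoodReductionAt_of_not_dvd_conductorNorm`, and the packaged `absGaloisRestrict_smul_geomTorsion_eq_of_regularKolyvaginPrime` (`E(K̄)[2^{n+1}] ⊆ E(K_λ)`)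 — the entry point of the regular consumers of card E4 group (β).

Statements and proofs are the quarry's VERBATIM (namespace moved to `…Theorems.OffBigImageOddLocalAtTwo.Engine`).  Nothing here proves the crux,
`BSDp W 2`, BSD or the summit; no registered stub is discharged (engine inputs only).  BSD is not proved.

Refs: [GrossLMS1991] §3 (3.1)–(3.3), §9; [McCallumLMS1991] §3 (Cor. 3.2, Prop. 3.1), §5; [SilvermanAEC2009] III.7–III.8, VII–VIII; Serre (1972) §5.3.
-/

set_option linter.dupNamespace false -- tree convention: `Summit.BirchSwinnertonDyer.BirchSwinnertonDyer.Theorems` (summit = sub-problem)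
set_option autoImplicit false

noncomputable section

namespace Summit.BirchSwinnertonDyer.BirchSwinnertonDyer.Theorems.OffBigImageOddLocalAtTwo.Engine

open scoped Classical Pointwise
open _root_.WeierstrassCurve NumberField IsDedekindDomain Field Function
open Literature.NumberTheory.GaloisRepresentations Literature.NumberTheory.EllipticCurves Literature.NumberTheory

section LocalTrivialityN

universe u

variable (W : WeierstrassCurve ℚ) {K : Type u} [Field K] [NumberField K]

/-- **Regular analogue of `exists_isArithFrobAt_mem_torsionFixing`** (McCallum §4 / Gross (3.2) at a REGULAR Kolyvagin prime):
`K` imaginary quadratic, `ℓ` inert in `K`, `h₀ ∈ Γ_ℚ` with `h₀² = 1` on `E(ℚ̄)[m]`, and a Frobenius `h` at a prime above `ℓ` acting as `h₀`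
on `E[m]` and as the complex conjugation `c₀` on `K`; then at every prime `𝔔 ∣ λ = (ℓ)` of `\bar ℤ_K` there is an arithmetic Frobenius
`F ∈ Γ_K` fixing `E(K̄)[m]` (`res F = h² = h₀² = 1` on `E[m]`). -/
theorem exists_isArithFrobAt_mem_torsionFixing_regular [W.IsElliptic] (hK : IsImaginaryQuadratic K)
    {m : ℕ} [NeZero m] {c₀ : absoluteGaloisGroup ℚ} (hc₀ : IsComplexConjugation (Rat.castHom ℝ) c₀)
    {h₀ : absoluteGaloisGroup ℚ} (hsq : ∀ P : geomTorsion W (m : ℤ), h₀ • h₀ • P = P)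
    {ℓ : ℕ} (hℓ : ℓ.Prime) (hinert : (Ideal.span {(ℓ : 𝓞 K)}).IsPrime)
    (hfrob : ∃ (v : HeightOneSpectrum (𝓞 ℚ)) (𝔓 : Ideal (absIntegers (𝓞 ℚ) ℚ)) (h : absoluteGaloisGroup ℚ),
      (ℓ : 𝓞 ℚ) ∈ v.asIdeal ∧ 𝔓 ∈ v.primesAbove ∧ IsArithFrobAt (𝓞 ℚ) h 𝔓 ∧
      (∀ P : geomTorsion W (m : ℤ), h • P = h₀ • P) ∧
      ∀ (e : K →ₐ[ℚ] AlgebraicClosure ℚ) (x : K), h • e x = c₀ • e x)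
    {w : HeightOneSpectrum (𝓞 K)} (hℓw : (ℓ : 𝓞 K) ∈ w.asIdeal)
    {𝔔 : Ideal (absIntegers (𝓞 K) K)} (h𝔔 : 𝔔 ∈ w.primesAbove) :
    ∃ F : absoluteGaloisGroup K, IsArithFrobAt (𝓞 K) F 𝔔 ∧
      F ∈ torsionFixing (W.baseChange K) (m : ℤ) := by
  classical
  haveI : Algebra.IsQuadraticExtension ℚ K := ⟨hK.1⟩
  haveI : IsTotallyComplex K := hK.2
  obtain ⟨v, 𝔓₀, h, hℓv, h𝔓₀, hh, hE, hKact⟩ := hfrob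
  have hHi := index_range_absGaloisRestrict_eq_finrank ℚ K
  haveI hHn : ((absGaloisRestrict ℚ K).range).Normal :=
    Subgroup.normal_of_index_eq_two (hHi.trans hK.1)
  set e₀ : K →ₐ[ℚ] AlgebraicClosure ℚ :=
    (Literature.NumberTheory.EllipticCurves.absClosureEquiv ℚ K).symm.toAlgHom.comp
      (IsScalarTower.toAlgHom ℚ K (AlgebraicClosure K)) with he₀
  have he₀x : ∀ x : K, e₀ x = (Literature.NumberTheory.EllipticCurves.absClosureEquiv ℚ K).symm (algebraMap K (AlgebraicClosure K) x) :=
    fun _ ↦ rfl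
  have hrange : ∀ γ : absoluteGaloisGroup ℚ,
      γ ∈ Set.range (absGaloisRestrict ℚ K) ↔ ∀ x : K, γ • e₀ x = e₀ x := fun γ ↦ by
    rw [mem_range_absGaloisRestrict_iff]
    refine forall_congr' fun x ↦ ?_
    rw [absGaloisTransport_apply, he₀x]
    constructor
    · intro h1
      apply (Literature.NumberTheory.EllipticCurves.absClosureEquiv ℚ K).injective
      rw [AlgEquiv.apply_symm_apply]
      exact h1
    · intro h1
      rw [h1, AlgEquiv.apply_symm_apply]
  have hc₀H : c₀ ∉ Set.range (absGaloisRestrict ℚ K) :=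
    hc₀.not_mem_range_absGaloisRestrict (L := K) IsTotallyComplex.isComplex
  have hhH : h ∉ (absGaloisRestrict ℚ K).range := by
    intro hmem
    have hmem' : h ∈ Set.range (absGaloisRestrict ℚ K) := hmem
    apply hc₀H
    rw [hrange]
    intro x
    rw [← hKact e₀ x]
    exact (hrange h).mp hmem' x
  -- `ℓ` unramified in `K`; a Frobenius `τ'` above `λ` with `res τ' = h²`
  have hunr : Algebra.IsUnramifiedIn (𝓞 K) v.asIdeal :=
    isUnramifiedIn_of_span_natCast_isPrime hℓ hinert hℓv
  have hIr := inertia_le_range_absGaloisRestrict_of_isUnramifiedIn (K := K) hunr h𝔓₀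
  obtain ⟨w', 𝔔₁, τ', hw'v, hwuniq, -, h𝔔₁w, -, hτ', hresτ'⟩ :=
    exists_place_inert_of_not_mem_range (F := ℚ) (M := K) (hK.1 ▸ Nat.prime_two) hHn
      (hHi.trans rfl) hunr h𝔓₀ hIr hh hhH
  have hww' : w = w' := by
    apply hwuniq
    apply HeightOneSpectrum.eq_of_natCast_mem_rat hℓ _ hℓv
    rw [HeightOneSpectrum.under_asIdeal, Ideal.under_def, Ideal.mem_comap, map_natCast]
    exact hℓw
  rw [hK.1] at hresτ'
  -- `τ'` fixes `E(K̄)[m]`: `res τ' = h²` acts as `h₀² = 1`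
  have hτ'fix : τ' ∈ torsionFixing (W.baseChange K) (m : ℤ) := by
    rw [mem_torsionFixing_iff]
    intro Q
    obtain ⟨P, rfl⟩ := (RatClosure.torsionEquiv (K := K) W (m : ℤ)).surjective Q
    rw [← RatClosure.torsionEquiv_smul W (m : ℤ) τ' P, hresτ', pow_two, mul_smul, hE, hE, hsq]
  -- conjugate `τ'` to the prescribed prime `𝔔 ∣ λ`
  rw [← hww'] at h𝔔₁w
  obtain ⟨δ, -, hF⟩ :=
    HeightOneSpectrum.exists_isArithFrobAt_conj_of_mem_primesAbove_holds h𝔔₁w h𝔔 hτ'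
  exact ⟨δ * τ' * δ⁻¹, hF, (torsionFixing_normal (W.baseChange K) (m : ℤ)).conj_mem _ hτ'fix δ⟩

/-- **Regular analogue of `absGaloisRestrict_smul_geomTorsion_eq_of_kolyvaginPrime(_pow)`** (McCallum §4: *"`λ` splits completely in `K(E[m])`"*):
under the hypotheses of `exists_isArithFrobAt_mem_torsionFixing_regular`, with `E/K` of good reduction at `λ = w` and `λ ∤ m`, the whole local
Galois group `Γ_{K_λ}` acts trivially on `E(K̄)[m]`, i.e. `E(K̄)[m] = E(K_λ)[m]`. -/
theorem absGaloisRestrict_smul_geomTorsion_eq_regular [W.IsElliptic] (hK : IsImaginaryQuadratic K)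
    {m : ℕ} [NeZero m] {c₀ : absoluteGaloisGroup ℚ} (hc₀ : IsComplexConjugation (Rat.castHom ℝ) c₀)
    {h₀ : absoluteGaloisGroup ℚ} (hsq : ∀ P : geomTorsion W (m : ℤ), h₀ • h₀ • P = P)
    {ℓ : ℕ} (hℓ : ℓ.Prime) (hinert : (Ideal.span {(ℓ : 𝓞 K)}).IsPrime)
    (hfrob : ∃ (v : HeightOneSpectrum (𝓞 ℚ)) (𝔓 : Ideal (absIntegers (𝓞 ℚ) ℚ)) (h : absoluteGaloisGroup ℚ),
      (ℓ : 𝓞 ℚ) ∈ v.asIdeal ∧ 𝔓 ∈ v.primesAbove ∧ IsArithFrobAt (𝓞 ℚ) h 𝔓 ∧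
      (∀ P : geomTorsion W (m : ℤ), h • P = h₀ • P) ∧
      ∀ (e : K →ₐ[ℚ] AlgebraicClosure ℚ) (x : K), h • e x = c₀ • e x)
    {w : HeightOneSpectrum (𝓞 K)} (hℓw : (ℓ : 𝓞 K) ∈ w.asIdeal)
    (hgood : (W.baseChange K).HasGoodReductionAt w) (hmw : (((m : ℕ) : ℤ) : 𝓞 K) ∉ w.asIdeal)
    (g : absoluteGaloisGroup (w.adicCompletion K)) (Q : geomTorsion (W.baseChange K) (m : ℤ)) :
    absGaloisRestrict K (w.adicCompletion K) g • Q = Q := by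
  have hq0 : ((m : ℕ) : ℤ) ≠ 0 := Int.natCast_ne_zero.mpr (NeZero.ne m)
  have h𝔓₀ : adicCompletionPrime K w ∈ w.primesAbove := adicCompletionPrime_mem_primesAbove K w
  obtain ⟨F, hF, hFfix⟩ := exists_isArithFrobAt_mem_torsionFixing_regular W hK hc₀ hsq hℓ hinert hfrob hℓw h𝔓₀
  have hDeq := decompositionSubgroup_adicCompletionPrime_eq_range K w
  have hI₀ : (adicCompletionPrime K w).inertia (absoluteGaloisGroup K) ≤
      torsionFixing (W.baseChange K) (m : ℤ) := fun τ hτ =>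
    (mem_torsionFixing_iff _ _).mpr fun Q' =>
      (W.baseChange K).smul_geomTorsion_eq_of_mem_inertia hgood hmw h𝔓₀ hτ Q'
  have hd : absGaloisRestrict K (w.adicCompletion K) g ∈
      (adicCompletionPrime K w).decompositionSubgroup (absoluteGaloisGroup K) := by
    rw [hDeq]; exact ⟨g, rfl⟩
  obtain ⟨k, i, u, hi, hu, hdeq⟩ := exists_eq_frobenius_pow_mul_of_mem_decompositionSubgroup
    h𝔓₀ hF (isOpen_torsionFixing (W.baseChange K) hq0) hd
  have hmem : absGaloisRestrict K (w.adicCompletion K) g ∈ torsionFixing (W.baseChange K) (m : ℤ) := by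
    rw [hdeq]
    exact Subgroup.mul_mem _ (Subgroup.mul_mem _ (Subgroup.pow_mem _ hFfix k) (hI₀ hi)) hu
  exact smul_eq_of_mem_torsionFixing _ _ hmem Q

/-- Good reduction of `E/K` at a place `w ∋ ℓ` from good reduction of `E/ℚ` at the rational place below. -/
theorem hasGoodReductionAt_baseChange_of_rat [W.IsElliptic] {ℓ : ℕ} (hℓ : ℓ.Prime)
    {v : HeightOneSpectrum (𝓞 ℚ)} (hℓv : (ℓ : 𝓞 ℚ) ∈ v.asIdeal) (hgood : W.HasGoodReductionAt v)
    {w : HeightOneSpectrum (𝓞 K)} (hℓw : (ℓ : 𝓞 K) ∈ w.asIdeal) :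
    (W.baseChange K).HasGoodReductionAt w := by
  have hwv : w.under (𝓞 ℚ) = v := by
    apply HeightOneSpectrum.eq_of_natCast_mem_rat hℓ _ hℓv
    rw [HeightOneSpectrum.under_asIdeal, Ideal.under_def, Ideal.mem_comap, map_natCast]
    exact hℓw
  haveI : w.asIdeal.LiesOver v.asIdeal := ⟨by rw [← hwv]; rfl⟩
  exact hasGoodReductionAt_baseChange_of_hasGoodReductionAt_rat W v w hgood

/-- `ℓ ∤ N_E` ⇒ good reduction of `E/ℚ` at the place `v ∋ ℓ` (conductor criterion + the prime/place dictionary). -/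
theorem hasGoodReductionAt_of_not_dvd_conductorNorm [W.IsElliptic] {ℓ : ℕ} (hℓ : ℓ.Prime)
    {v : HeightOneSpectrum (𝓞 ℚ)} (hℓv : (ℓ : 𝓞 ℚ) ∈ v.asIdeal) (hN : ¬ ℓ ∣ W.conductorNorm ℤ) :
    W.HasGoodReductionAt v := by
  have hv : (Rat.HeightOneSpectrum.primesEquiv v : ℕ) = ℓ :=
    (Nat.prime_dvd_prime_iff_eq (Rat.HeightOneSpectrum.primesEquiv v).2 hℓ).mp
      ((Literature.NumberTheory.EllipticCurves.DeuringLadic.natCast_mem_asIdeal_iff v ℓ).mp hℓv)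
  haveI : Fact (Rat.HeightOneSpectrum.primesEquiv v : ℕ).Prime := ⟨(Rat.HeightOneSpectrum.primesEquiv v).2⟩
  have h := hasGoodReductionAtPrime_of_not_dvd_conductorNorm W
    (ℓ := (Rat.HeightOneSpectrum.primesEquiv v : ℕ)) (by rw [hv]; exact hN)
  exact (WeierstrassCurve.hasGoodReductionAtPrime_iff_hasGoodReductionAt_ringOfIntegers v W).mp h

/-- **Packaged for the §K/§M regular Kolyvagin primes**: `Γ_{K_λ}` fixes `E(K̄)[2^{n+1}]` at every regular Kolyvagin prime `ℓ ∤ N_E` produced by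
`exists_regular_kolyvaginPrime_of_heegner` (its clauses `ℓ.Prime`, `¬ ℓ ∣ W.conductorNorm ℤ`, `ℓ ≠ 2`, `(ℓ)` prime in `𝓞 K`, the Frobenius clause, and
the involution clause `hsq` of `h = c₀ · res ρ`). -/
theorem absGaloisRestrict_smul_geomTorsion_eq_of_regularKolyvaginPrime [W.IsElliptic] (hK : IsImaginaryQuadratic K)
    (n : ℕ) {c₀ : absoluteGaloisGroup ℚ} (hc₀ : IsComplexConjugation (Rat.castHom ℝ) c₀) {ρ : absoluteGaloisGroup K}
    (hsq : ∀ X : geomTorsion W ((2 ^ (n + 1) : ℕ) : ℤ),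
      (c₀ * absGaloisRestrict ℚ K ρ) • (c₀ * absGaloisRestrict ℚ K ρ) • X = X)
    {ℓ : ℕ} (hℓ : ℓ.Prime) (hN : ¬ ℓ ∣ W.conductorNorm ℤ) (hℓ2 : ℓ ≠ 2) (hinert : (Ideal.span {(ℓ : 𝓞 K)}).IsPrime)
    (hfrob : ∃ (v : HeightOneSpectrum (𝓞 ℚ)) (𝔓 : Ideal (absIntegers (𝓞 ℚ) ℚ)) (h : absoluteGaloisGroup ℚ),
      (ℓ : 𝓞 ℚ) ∈ v.asIdeal ∧ 𝔓 ∈ v.primesAbove ∧ IsArithFrobAt (𝓞 ℚ) h 𝔓 ∧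
      (∀ P : geomTorsion W ((2 ^ (n + 1) : ℕ) : ℤ), h • P = (c₀ * absGaloisRestrict ℚ K ρ) • P) ∧
      ∀ (e : K →ₐ[ℚ] AlgebraicClosure ℚ) (x : K), h • e x = c₀ • e x)
    {w : HeightOneSpectrum (𝓞 K)} (hℓw : (ℓ : 𝓞 K) ∈ w.asIdeal)
    (g : absoluteGaloisGroup (w.adicCompletion K)) (Q : geomTorsion (W.baseChange K) ((2 ^ (n + 1) : ℕ) : ℤ)) :
    absGaloisRestrict K (w.adicCompletion K) g • Q = Q := by
  haveI : NeZero (2 ^ (n + 1)) := ⟨pow_ne_zero _ two_ne_zero⟩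
  obtain ⟨v, 𝔓, h, hℓv, h𝔓, hh, hE, hKact⟩ := hfrob
  have hgood : (W.baseChange K).HasGoodReductionAt w :=
    hasGoodReductionAt_baseChange_of_rat W hℓ hℓv (hasGoodReductionAt_of_not_dvd_conductorNorm W hℓ hℓv hN) hℓw
  have h2w : ((2 : ℕ) : 𝓞 K) ∉ w.asIdeal := not_natCast_mem_of_prime_ne hℓ Nat.prime_two hℓ2 w hℓw
  have hmw : ((((2 ^ (n + 1) : ℕ) : ℤ)) : 𝓞 K) ∉ w.asIdeal := fun hm ↦ by
    apply h2w
    rw [Int.cast_natCast, Nat.cast_pow] at hm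
    exact w.isPrime.mem_of_pow_mem _ hm
  exact absGaloisRestrict_smul_geomTorsion_eq_regular W hK hc₀ hsq hℓ hinert ⟨v, 𝔓, h, hℓv, h𝔓, hh, hE, hKact⟩ hℓw
    hgood hmw g Q

end LocalTrivialityN

end Summit.BirchSwinnertonDyer.BirchSwinnertonDyer.Theorems.OffBigImageOddLocalAtTwo.Engine

end
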